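import Summits.BirchSwinnertonDyer.Rank1Residual.Additive.ChiBranchRatLowerDvdOdd
import Summits.BirchSwinnertonDyer.Rank1Residual.Additive.GordChiBranchWuthrichComponent
import Summits.BirchSwinnertonDyer.Rank1Residual.AdditivePotMult.CyclotomicThreeOfHalf
import Literature.NumberTheory.EllipticCurves.Wuthrich2014.ReducibleDivisibilityCyclotomicPrimeComponentOfHalf
import Literature.NumberTheory.EllipticCurves.Kato2004.Condition1252SemistableProofs
import HarnessLib

/-!
# Further ENDS over the one-sided rational Skinner–Urban containment `ChiBranchRatLowerDvdOddAt`
# (odd branch): §A X4♯(G-ord) ∩ `I₀*` at `p ≡ 3 (mod 4)`, `p ≥ 7` (Kato's half, Serre's tower);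
# §B the REDUCIBLE rows (X3): Wuthrich's printed half (Thm. 16, no image hypothesis) upgrades the node
# to the rational odd-branch main conjecture, and the X3♯(G-ord)@3 ends
# (cell `b2b-bsdres`, team n1011, seat n1011-p06 gen 2, OWNERS row T-N10R, phase 4, odd-node ENDS sibling)

HONEST FRAMING (cell `b2b-bsdres`, run/shared/lean/b2b/bsd-rank1-residual/, verbatim in every
file): the goal of the cell is to DELETE the COMBINATION-SHAPED residual classes of the
Birch–Swinnerton-Dyer formula for ALL analytic-rank `≤ 1` elliptic curves over `ℚ` — "full BSD
formula for every rank `≤ 1` curve in class `C`" assembled STRICTLY from published theorems — so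
that the rank-`≤ 1` remainder becomes exactly the CONSTRUCTION-SHAPED classes, which are TYPED
(missing-input `Prop`s), NOT attempted. This is not "finishing BSD". Team n1011 (X4 ∧ `p = 3` / the
additive block, §I items N10 / N11): research routes; prove what is provable now; no claim beyond
the stated classes; X3♯(G-ord) stays CONSTRUCTION-SHAPED; labels / census / located gap UNCHANGED;
nothing is booked. Theorems only (no definition, no named fact minted; the Literature inputs are the
explicit binders `hWu` = Wuthrich 2014 Thm. 16 half-eigenspace reading, `hDel3`, `hDel`).

## What and why

Sibling of `ChiBranchRatLowerDvdOdd.lean` (same seat), whose §3 gave the `p = 3` ends. §A here: on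
X4♯(G-ord) ∩ `I₀*` ∩ surj(p) at `p ≡ 3 (mod 4)`, `p ≥ 7`, the tower from surj(p) is Serre's
(`forall_hasSurjectiveModNGaloisRep_pow_of_surj_of_five_le_or_semistable`, PROVED), so
`ChiBranchRatLowerDvdOddAt W p` + Kato's half ⟹ `ChiBranchRatCharEqOddAt W p` ⟹ (p249862's
`ClassX4Gord.…_of_ratCharEqOdd_of_unitCoeff[_of_katoHalf]`, Delbourgo 2002 `hDel`) the LOWER half and
`BSD(E,p)` off the anomalous rows. §B: there, on the IRREDUCIBLE rows, Kato's printed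
half (big image, tower surjectivity) + the typed one-sided RATIONAL Skinner–Urban containment
`ChiBranchRatLowerDvdOddAt W p` gave the rational odd-branch main conjecture `ChiBranchRatCharEqOddAt W p`
(p249862's input). On the REDUCIBLE rows (`Red W p`: `E[p]` reducible — class X3) the printed half is
Wuthrich 2014 Thm. 16 ("Suppose that `E` has semi-stable reduction at `p` and that `E[p]` is reducible
as a `G_ℚ`-module. Then `char_Λ X(E)` divides the ideal generated by `L_p(E)`", p. 397), applied to the
good-ordinary twist `V = E♭` (reducible `V[p]`, since `W = C • V^{(−p)}`), component `(p−1)/2`, in the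
general half-eigenspace form `Wuthrich2014.thm16_halfEigenCharIdeal_dvd_cyclotomicPrime` (referee
ruling R118.3) specialised by `Wuthrich2014.charIdeal_dvd_padicLFunctionBranch_component_of_half`, and
transported to `X(W/ℚ_∞)` exactly as in additive-p2's reducible Brick 5′
(`chiBranchLeadingTermOddAt_of_wuthrichComponent`, which exported only the `T = 0` shadow). NO image or
tower hypothesis is needed. So:

* §B1 `exists_mem_charIdeal_map_eq_unit_mul_minusBranch_of_wuthrichHalf` — Wuthrich's half on
  `X(W/ℚ_∞)` as a full power-series identity `ι g₁ = u · ϖ⁻ · L_p⁻(f♭, α, ω^{(p−1)/2}, T)`;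
* §B2 `chiBranchRatCharEqOddAt_of_wuthrichHalf_of_ratLowerDvd` — on `Red W p ∧ 0 ≤ ord_p j(W)`:
  `ChiBranchRatLowerDvdOddAt W p` ⟹ `ChiBranchRatCharEqOddAt W p` (same `Λ ⊗ ℚ_p` bookkeeping,
  `exists_span_eq_and_map_eq_C_zpow_mul`);
* §B3 X3♯(G-ord) at `3`, `r_an = 0`, non-CM, non-anomalous: `BSD(E,3)` ⟸ `ChiBranchRatLowerDvdOddAt W 3`
  + ONE unit coefficient + printed facts (p252109's `ClassX3Gord.bsdp_three_rankZero_of_ratCharEqOdd_of_unitCoeff`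
  with `hW16 := thm16_minusEigenCharIdeal_dvd_cyclotomicThree_of_half hWu`), and on the unit rows from
  `ChiBranchRatLowerDvdOddAt W 3` ALONE.

On X3 the residually REDUCIBLE shape of `ρ̄` is exactly the setting of Greenberg–Vatsal 2000 for the
trivial branch; the branch version is n1011-p12's typed `X3BranchMainConjectureAt` (row T-c2x3) —
this file does not touch it. X3♯(G-ord) stays CONSTRUCTION-SHAPED; nothing booked; no label change.

References: C. Wuthrich, J. London Math. Soc. 90 (2014) Thm. 16 (p. 397), §3 (p. 390)
[Wuthrich2014]; C. Skinner, E. Urban, Invent. Math. 195 (2014) Cor. 3.6.2 (p. 42), Thm. 3.6.4 (p. 43)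
[SkinnerUrban2014]; Mazur–Tate–Teitelbaum, Invent. Math. 84 (1986) §I.12–I.14
[MazurTateTeitelbaum1986Invent]; R. Greenberg, LNM 1716 (1999) §5 (p. 143) [GreenbergLNM1716];
D. Delbourgo, J. Number Theory 95 (2002) Theorem (A), (B) (p. 40) [Delbourgo2002]; D. Delbourgo,
Compositio Math. 113 (1998) Prop. 4 (p. 144) [Delbourgo1998]; R. L. Miller, LMS J. Comput. Math. 14
(2011) Def. 1.1 [Miller2011LMS]; R. Greenberg, V. Vatsal, Invent. Math. 142 (2000) [GreenbergVatsal2000].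
-/

noncomputable section

open scoped Classical MatrixGroups ModularForm NumberField

open CongruenceSubgroup WeierstrassCurve NumberField Literature.NumberTheory.EllipticCurves
  Literature.NumberTheory.EllipticCurves.ModularForms
  Literature.NumberTheory.EllipticCurves.Rank1Residual
  Literature.NumberTheory.EllipticCurves.Rank1Residual.Typed
  Literature.NumberTheory.GaloisRepresentations
  IsDedekindDomain

namespace Summit.BirchSwinnertonDyer.Rank1Residual.Additive

open AdditivePotMult

/-! ### §A X4♯(G-ord) ∩ `I₀*` ∩ surj(p), `p ≡ 3 (mod 4)`, `p ≥ 7`: ends over the odd node -/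

section LargeOdd

variable {W : WeierstrassCurve ℚ} [W.IsElliptic] {p : ℕ} [hp : Fact p.Prime]

/-- **X4♯(G-ord) ∩ surj(p), `p ≥ 5`, `p ≡ 3 (mod 4)`: the rational odd-branch main conjecture from its
Skinner–Urban half** — tower from surj(p) by Serre (`p ≥ 5`, PROVED in the tree), `0 ≤ ord_p j` from
`TypeGOrd`, Kato's half `hKW`. [cite: Kato2004Asterisque, Thm. 17.4 (3) (p. 273)]
[cite: SerreAbelianLadic1968, Ch. IV §3.4, Lemma 3 (IV-23)] [cite: SkinnerUrban2014, Thm. 3.6.4, proof (p. 43)] -/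
theorem ClassX4Gord.chiBranchRatCharEqOddAt_of_katoHalf_of_ratLowerDvd_of_surj
    (hKW : Wuthrich2014.kato_halfEigenCharIdeal_dvd_cyclotomicPrime_of_surjective)
    (hX : ClassX4Gord W p) (hp5 : 5 ≤ p) (hsurj : Surj W p) (hE : ChiBranchRatLowerDvdOddAt W p) :
    ChiBranchRatCharEqOddAt W p :=
  chiBranchRatCharEqOddAt_of_katoHalf_of_ratLowerDvd hKW (padicValRat_j_nonneg_of_typeGOrd W p hX.typeGOrd)
    (W.forall_hasSurjectiveModNGaloisRep_pow_of_surj_of_five_le_or_semistable p hX.addv.1 (Or.inl hp5)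
      hsurj) hE

variable [W.IsGloballyMinimal]

/-- **X4♯(G-ord) ∩ `I₀*` ∩ surj(p) ∩ non-anomalous, `p ≡ 3 (mod 4)`, `p ≥ 5` (so `p ≥ 7`), non-CM,
`r_an = 0`: the LOWER half `ord_p #Ш_an ≤ ord_p #Ш` ⟸ `ChiBranchRatLowerDvdOddAt W p` + ONE unit
coefficient** (+ Kato's half `hKW`, Delbourgo 2002 `hDel`, GZK, modularity; p249862's
`ClassX4Gord.missingLowerBoundAt_rankZero_of_ratCharEqOdd_of_unitCoeff`). X4♯(G-ord) stays
CONSTRUCTION-SHAPED. [cite: SkinnerUrban2014, Cor. 3.6.2 (p. 42) (shape only)]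
[cite: Kato2004Asterisque, Thm. 17.4 (3) (p. 273)] [cite: Delbourgo2002, Theorem (A), (B) (p. 40)]
[cite: Miller2011LMS, Def. 1.1] -/
theorem ClassX4Gord.missingLowerBoundAt_rankZero_of_ratLowerDvdOdd_of_unitCoeff_of_surj
    (hKW : Wuthrich2014.kato_halfEigenCharIdeal_dvd_cyclotomicPrime_of_surjective)
    (hDel : Delbourgo2002.mainTheorem)
    (hGZK : rank_eq_analyticRank_of_analyticRank_le_one) (hmod : hasEntireLFunction_rat)
    (hmodD : nonempty_modularParametrizationData)
    (hX : ClassX4Gord W p) (he : semistabilityIndex W p = 2) (hp5 : 5 ≤ p) (hp4 : p % 4 = 3)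
    (hcm : ¬ W.HasCM) (hr : W.analyticRank = 0) (hna : Delbourgo2002.ReductionNonAnomalous W p)
    (hsurj : Surj W p) (hE : ChiBranchRatLowerDvdOddAt W p)
    (hcert : ∀ (V : WeierstrassCurve ℚ) [V.IsElliptic] [V.IsGloballyMinimal] (C : VariableChange ℚ),
      GoodOrd V p → C • V.quadraticTwist (-(p : ℚ)) = W →
      ∀ {N : ℕ} [NeZero N] (f : CuspForm (Gamma0 N) 2), IsNewformOf V f →
      ∀ ϖ : ℚ, (ϖ : ℝ) * V.imaginaryPeriodRat = minusPeriod f →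
      ∃ n : ℕ, ‖PowerSeries.coeff n
        (PowerSeries.C (ϖ : ℚ_[p]) * padicLFunctionMinusBranch f (unitRoot V p : ℚ_[p]) (p / 2))‖ = 1) :
    MissingLowerBoundAt W p :=
  ClassX4Gord.missingLowerBoundAt_rankZero_of_ratCharEqOdd_of_unitCoeff hDel hGZK hmod hmodD hX he hp5 hp4
    hcm hr hna (hX.chiBranchRatCharEqOddAt_of_katoHalf_of_ratLowerDvd_of_surj hKW hp5 hsurj hE) hcert

/-- **X4♯(G-ord) ∩ `I₀*` ∩ surj(p) ∩ non-anomalous, `p ≡ 3 (mod 4)`, `p ≥ 7`, non-CM, `r_an = 0`: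
`BSD(E,p)` ⟸ the ONE-SIDED rational Skinner–Urban containment on the odd branch (`ChiBranchRatLowerDvdOddAt W p`)
+ ONE unit coefficient, and NOTHING ELSE typed** (Kato's half `hKW` serves the upgrade AND the upper
half: p249862's `ClassX4Gord.bsdp_rankZero_of_ratCharEqOdd_of_unitCoeff_of_katoHalf`). Nothing booked.
[cite: SkinnerUrban2014, Cor. 3.6.2 (p. 42), Thm. 3.6.4 (p. 43) (shape only)]
[cite: Kato2004Asterisque, Thm. 17.4 (3) (p. 273)] [cite: Delbourgo2002, Theorem (A), (B) (p. 40)]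
[cite: Delbourgo1998, Prop. 4 (p. 144)] [cite: Miller2011LMS, §1 and Def. 1.1] -/
theorem ClassX4Gord.bsdp_rankZero_of_ratLowerDvdOdd_of_unitCoeff_of_surj
    (hKW : Wuthrich2014.kato_halfEigenCharIdeal_dvd_cyclotomicPrime_of_surjective)
    (hDel : Delbourgo2002.mainTheorem)
    (hDel98 : Delbourgo1998.prop4_rankZero_pow_dvd_constantCoeff)
    (hGZK : rank_eq_analyticRank_of_analyticRank_le_one) (hmod : hasEntireLFunction_rat)
    (hmodD : nonempty_modularParametrizationData)
    (hX : ClassX4Gord W p) (he : semistabilityIndex W p = 2) (hp5 : 5 ≤ p) (hp4 : p % 4 = 3)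
    (hcm : ¬ W.HasCM) (hr : W.analyticRank = 0) (hna : Delbourgo2002.ReductionNonAnomalous W p)
    (hsurj : Surj W p) (hE : ChiBranchRatLowerDvdOddAt W p)
    (hcert : ∀ (V : WeierstrassCurve ℚ) [V.IsElliptic] [V.IsGloballyMinimal] (C : VariableChange ℚ),
      GoodOrd V p → C • V.quadraticTwist (-(p : ℚ)) = W →
      ∀ {N : ℕ} [NeZero N] (f : CuspForm (Gamma0 N) 2), IsNewformOf V f →
      ∀ ϖ : ℚ, (ϖ : ℝ) * V.imaginaryPeriodRat = minusPeriod f →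
      ∃ n : ℕ, ‖PowerSeries.coeff n
        (PowerSeries.C (ϖ : ℚ_[p]) * padicLFunctionMinusBranch f (unitRoot V p : ℚ_[p]) (p / 2))‖ = 1) :
    BSDp W p :=
  ClassX4Gord.bsdp_rankZero_of_ratCharEqOdd_of_unitCoeff_of_katoHalf hDel hKW hDel98 hGZK hmod hmodD hX
    he hp5 hp4 hcm hr hna hsurj (hX.chiBranchRatCharEqOddAt_of_katoHalf_of_ratLowerDvd_of_surj hKW hp5 hsurj hE)
    hcert

end LargeOdd

/-! ### §B1 Wuthrich's half on `X(E/ℚ_∞)` — the full series (reducible Brick 5′ before `T = 0`) -/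

section WuthrichHalf

variable (W : WeierstrassCurve ℚ) [W.IsElliptic] (p : ℕ) [hp : Fact p.Prime]

/-- **Wuthrich's half of the odd-branch main conjecture, on the additive curve's `X(E/ℚ_∞)`, as a
power series identity (reducible `E[p]`).** For `W/ℚ` potentially good at `p ≡ 3 (mod 4)`
(`0 ≤ ord_p j(W)`) with `W[p]` REDUCIBLE, every globally minimal `V`, good ordinary or multiplicative
at `p` (the multiplicative case is vacuous), with `C • V^{(−p)} = W`, every cyclotomic `κ/γ` matching the
cyclotomic variable, newform `f` of `V`, `Λ`-dual datum `D` of `Sel_{p^∞}(W/ℚ_∞)` and `ϖ·|Ω⁻(V)| = Ω⁻_f`: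
`X(W/ℚ_∞)` is `Λ`-torsion and some `g ∈ char_Λ X(W/ℚ_∞)` has `ι g = u · ϖ · L_p⁻(f, α, ω^{(p−1)/2}, T)`,
`u ∈ ℤ_pˣ`. No image hypothesis. This is additive-p2's `chiBranchLeadingTermOddAt_of_wuthrichComponent`
stopped BEFORE the constant term, over the half-eigenspace form `hWu` via `…_component_of_half`.
[cite: Wuthrich2014, Thm. 16 (p. 397), §3 (p. 390)] [cite: GreenbergLNM1716, §5 p. 143]
[cite: MazurTateTeitelbaum1986Invent, §I.13] -/
theorem exists_mem_charIdeal_map_eq_unit_mul_minusBranch_of_wuthrichHalf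
    (hWu : Wuthrich2014.thm16_halfEigenCharIdeal_dvd_cyclotomicPrime)
    (hj : 0 ≤ padicValRat p W.j) (hredW : Red W p)
    (V : WeierstrassCurve ℚ) [V.IsElliptic] [V.IsGloballyMinimal]
    {κ : ZpExtension ℚ p} {γ : Field.absoluteGaloisGroup ℚ} {N : ℕ} [NeZero N]
    {f : CuspForm (Gamma0 N) 2} (hp3 : p % 4 = 3)
    (hCW : ∃ C : VariableChange ℚ, C • V.quadraticTwist (-(p : ℚ)) = W) (hred : GoodOrd V p ∨ Mult V p)
    (hκ : κ.IsCyclotomic) (hγ : κ.IsTopGenerator γ) (hcv : IsCyclotomicVariable p γ)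
    (hf : IsNewformOf V f) (D : W.SelmerDualData κ γ) (ϖ : ℚ)
    (hϖ : (ϖ : ℝ) * V.imaginaryPeriodRat = minusPeriod f) :
    D.IsTorsion ∧ ∃ g ∈ D.charIdeal, ∃ u : ℤ_[p]ˣ,
      iwasawaToPowerSeries p g =
        PowerSeries.C (((u : ℤ_[p]) : ℚ_[p]) * (ϖ : ℚ_[p])) *
          padicLFunctionMinusBranch f (unitRoot V p : ℚ_[p]) (p / 2) := by
  have hK := Wuthrich2014.charIdeal_dvd_padicLFunctionBranch_component_of_half hWu
  have hp2 : p ≠ 2 := by rintro rfl; norm_num at hp3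
  have hpne : (-(p : ℚ)) ≠ 0 := neg_ne_zero.mpr (Nat.cast_ne_zero.mpr hp.out.ne_zero)
  have hodd : ¬ Even (p / 2) := by rw [Nat.not_even_iff_odd]; exact ⟨p / 4, by omega⟩
  -- `V` is good ordinary
  have hord : IsOrdinaryAt V p := isOrdinaryAt_of_goodOrd_or_mult_of_model_twist W V hpne hCW hj hred
  obtain ⟨C, hC⟩ := hCW
  -- the fields `F = ℚ(ζ_p) ⊇ K = ℚ(√−p)`
  haveI hcycL : IsCyclotomicExtension {p} ℚ (CyclotomicField p ℚ) := by
    have h : (CyclotomicField.algebra p ℚ : Algebra ℚ (CyclotomicField p ℚ)) =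
        DivisionRing.toRatAlgebra := Subsingleton.elim _ _
    exact h ▸ CyclotomicField.isCyclotomicExtension p ℚ
  obtain ⟨K, θ, hK2, hθ, hθ2⟩ := exists_intermediateField_sq_eq_pStar p (CyclotomicField p ℚ) hp2
  haveI : NumberField K := NumberField.of_module_finite ℚ K
  have hcK : θ ^ 2 = algebraMap ℚ K (-(p : ℚ)) := by
    rw [hθ2, pStar_eq_neg_of_mod_four_eq_three hp3]
  haveI : IsGalois ℚ K := isGalois_of_finrank_eq_two K hK2
  haveI := normal_galRange K hK2 (sigmaQ_ne_one K hK2 hθ hcK)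
  haveI := normal_galRange_cyclotomic p (CyclotomicField p ℚ)
  haveI : (V.quadraticTwist (-(p : ℚ))).IsElliptic := V.isElliptic_quadraticTwist hpne
  -- the `Λ`-dual datum of `e_{(p−1)/2} Sel(V/ℚ(μ_{p^∞}))` at a normalised generator, same `char`
  obtain ⟨γ', hγ'KF, hκγ', ⟨g₀, hg₀, hγ'eq⟩, D', hchar, htor⟩ :=
    SelmerDualData.exists_chiEigenInCyclotomic p (CyclotomicField p ℚ) V K hK2 hθ hcK κ hC hp2 D
  -- the fact, applied to that datum
  obtain ⟨htorX, g, hgmem, u, hιg⟩ := hK p V K (CyclotomicField p ℚ) (κ := κ) (γ := γ') (f := f)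
    (chiEigenSelmerIn V K p κ (galRange (K := ℚ) (CyclotomicField p ℚ)))
    (fun t ht ↦ conjH1_mem_chiEigenSelmerIn γ' ht) D'.X D'.toDual hp2 hK2 ⟨θ, hθ2⟩ hord
    (fun hV ↦ hredW ((irr_iff_of_model_twist (W := V) (p := p) hpne ⟨C, hC⟩).mpr hV)) hκ
    (isTopGenerator_of_kappa_eq κ hκγ' hγ)
    (isCyclotomicVariable_of_eq_mul p κ hκ hg₀ hγ'eq hcv)
    (Subgroup.mem_inf.mp hγ'KF).1 (Subgroup.mem_inf.mp hγ'KF).2 hf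
    (mem_chiEigenSelmerIn_iff_ite V K κ _) D'.bijective D'.toDual_T_smul D'.toDual_C_smul ϖ
    (by rw [if_neg hodd]; exact hϖ)
  refine ⟨htor.mp htorX, g, hchar ▸ hgmem, u, ?_⟩
  rw [hιg, if_neg hodd]

end WuthrichHalf

/-! ### §B2 The split on the reducible rows: Wuthrich's half + the typed one-sided containment -/

section Split

variable {W : WeierstrassCurve ℚ} [W.IsElliptic] {p : ℕ} [hp : Fact p.Prime]

/-- **Wuthrich's printed half + the typed RATIONAL Skinner–Urban containment ⟹ the rational odd-branch
main conjecture `ChiBranchRatCharEqOddAt W p`, on the REDUCIBLE rows — no image hypothesis.** For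
`W/ℚ` with `0 ≤ ord_p j(W)` and `W[p]` reducible: from §1, `g₁ ∈ char_Λ X` with `ι(u⁻¹ g₁) = ϖ L⁻`;
from the typed input at a generator `g` of `char_Λ X`, `p^m g ∈ (G)`, `ι G = p^n ϖ L⁻`; two
divisibilities in `Λ ⊗ ℚ_p` give `char_Λ X = (g')`, `ι g' = p^k ϖ L⁻`
(`exists_span_eq_and_map_eq_C_zpow_mul`, the bookkeeping of SU 2014 Thm. 3.6.4, p. 43).
[cite: Wuthrich2014, Thm. 16 (p. 397)] [cite: SkinnerUrban2014, Thm. 3.6.4, proof (p. 43)] -/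
theorem chiBranchRatCharEqOddAt_of_wuthrichHalf_of_ratLowerDvd
    (hWu : Wuthrich2014.thm16_halfEigenCharIdeal_dvd_cyclotomicPrime)
    (hj : 0 ≤ padicValRat p W.j) (hredW : Red W p) (hE : ChiBranchRatLowerDvdOddAt W p) :
    ChiBranchRatCharEqOddAt W p := by
  intro V _ _ κ γ N _ f hp3 hCW hV hκ hγ hcv hf D ϖ hϖ
  -- Wuthrich's half (§1)
  obtain ⟨htor, g₁, hg₁, u, hιg₁⟩ :=
    exists_mem_charIdeal_map_eq_unit_mul_minusBranch_of_wuthrichHalf W p hWu hj hredW V hp3 hCW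
      (Or.inl hV) hκ hγ hcv hf D ϖ hϖ
  -- a generator of `char`, and the typed containment at it
  obtain ⟨g, hchar, -⟩ := exists_charIdeal_eq_span_singleton p D
  obtain ⟨G, m, n, hG, hιG⟩ := hE V hp3 hCW hV hκ hγ hcv hf D ϖ hϖ g
    (by rw [hchar]; exact Ideal.mem_span_singleton_self g)
  -- normalise Wuthrich's element: `u⁻¹ g₁ ∈ (g)` with `ι (u⁻¹ g₁) = p^0 · ϖ L⁻`
  have hg₁' : PowerSeries.C ((u⁻¹ : ℤ_[p]ˣ) : ℤ_[p]) * g₁ ∈ Ideal.span {g} := by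
    rw [← hchar]; exact Ideal.mul_mem_left _ _ hg₁
  have hCu : iwasawaToPowerSeries p (PowerSeries.C ((u⁻¹ : ℤ_[p]ˣ) : ℤ_[p])) =
      PowerSeries.C ((((u⁻¹ : ℤ_[p]ˣ) : ℤ_[p]) : ℚ_[p])) := by
    rw [PowerSeries.map_C, PadicInt.algebraMap_apply]
  have hu0 : (((u : ℤ_[p]) : ℚ_[p])) ≠ 0 := by
    intro h0
    have h1 : (((u⁻¹ : ℤ_[p]ˣ) : ℤ_[p]) : ℚ_[p]) * (((u : ℤ_[p]) : ℚ_[p])) = 1 := by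
      rw [← PadicInt.coe_mul, Units.inv_mul, PadicInt.coe_one]
    rw [h0, mul_zero] at h1
    exact zero_ne_one h1
  have hιg₁' : iwasawaToPowerSeries p (PowerSeries.C ((u⁻¹ : ℤ_[p]ˣ) : ℤ_[p]) * g₁) =
      PowerSeries.C ((p : ℚ_[p]) ^ (0 : ℕ)) *
        (PowerSeries.C (ϖ : ℚ_[p]) * padicLFunctionMinusBranch f (unitRoot V p : ℚ_[p]) (p / 2)) := by
    rw [pow_zero, map_one, one_mul, map_mul, hιg₁, hCu, ← mul_assoc, ← map_mul, coe_units_inv_eq_inv,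
      ← mul_assoc, inv_mul_cancel₀ hu0, one_mul]
  -- two divisibilities in `Λ ⊗ ℚ_p` ⟹ a generator `g'` with `ι g' = p^k · ϖ L⁻`
  obtain ⟨g', k, hspan, hιg'⟩ := exists_span_eq_and_map_eq_C_zpow_mul p hg₁' hιg₁' hG hιG
  refine ⟨htor, g', k, hchar.trans hspan, ?_⟩
  rw [hιg', map_mul, mul_assoc]

/-- **X3♯(G-ord) (`Red W p`, type (G)-ordinary, so `0 ≤ ord_p j`), `p ≡ 3 (mod 4)`: the rational
odd-branch main conjecture from its Skinner–Urban half**, no image hypothesis.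
[cite: Wuthrich2014, Thm. 16 (p. 397)] [cite: SkinnerUrban2014, Thm. 3.6.4, proof (p. 43)] -/
theorem ClassX3Gord.chiBranchRatCharEqOddAt_of_ratLowerDvdOdd
    (hWu : Wuthrich2014.thm16_halfEigenCharIdeal_dvd_cyclotomicPrime)
    (hX : ClassX3Gord W p) (hE : ChiBranchRatLowerDvdOddAt W p) : ChiBranchRatCharEqOddAt W p :=
  chiBranchRatCharEqOddAt_of_wuthrichHalf_of_ratLowerDvd hWu
    (padicValRat_j_nonneg_of_typeGOrd W p hX.typeGOrd) hX.classX3.1 hE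

end Split

/-! ### §B3 X3♯(G-ord) at `3`: ends over `ChiBranchRatLowerDvdOddAt W 3` + ONE unit coefficient -/

section Three

variable {W : WeierstrassCurve ℚ} [W.IsElliptic] [W.IsGloballyMinimal]

/-- **X3♯(G-ord) at `3`, `r_an = 0`, non-CM, OFF the anomalous rows: the LOWER half
`ord₃ #Ш_an ≤ ord₃ #Ш` ⟸ the one-sided rational Skinner–Urban containment on the odd branch
(`ChiBranchRatLowerDvdOddAt W 3`) + ONE unit coefficient** (+ Wuthrich's half `hWu`, Delbourgo 2002
at `3` `hDel3`, GZK, modularity; p252109's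
`ClassX3Gord.missingLowerBoundAt_three_rankZero_of_ratCharEqOdd_of_unitCoeff`). No image hypothesis.
X3♯(G-ord) stays CONSTRUCTION-SHAPED. [cite: Wuthrich2014, Thm. 16 (p. 397)]
[cite: SkinnerUrban2014, Cor. 3.6.2 (p. 42) (shape only)] [cite: Delbourgo2002, Theorem (A), (B) (p. 40)]
[cite: Miller2011LMS, Def. 1.1] -/
theorem ClassX3Gord.missingLowerBoundAt_three_rankZero_of_ratLowerDvdOdd_of_unitCoeff
    [Fact (Nat.Prime 3)]
    (hWu : Wuthrich2014.thm16_halfEigenCharIdeal_dvd_cyclotomicPrime)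
    (hDel3 : Delbourgo2002.mainTheorem_three)
    (hGZK : rank_eq_analyticRank_of_analyticRank_le_one) (hmod : hasEntireLFunction_rat)
    (hmodD : nonempty_modularParametrizationData)
    (hX : ClassX3Gord W 3) (hcm : ¬ W.HasCM) (hr : W.analyticRank = 0)
    (hna : Delbourgo2002.ReductionNonAnomalous W 3) (hE : ChiBranchRatLowerDvdOddAt W 3)
    (hcert : ∀ (V : WeierstrassCurve ℚ) [V.IsElliptic] [V.IsGloballyMinimal] (C : VariableChange ℚ),
      GoodOrd V 3 → C • V.quadraticTwist (-(3 : ℚ)) = W →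
      ∀ {N : ℕ} [NeZero N] (f : CuspForm (Gamma0 N) 2), IsNewformOf V f →
      ∀ ϖ : ℚ, (ϖ : ℝ) * V.imaginaryPeriodRat = minusPeriod f →
      ∃ n : ℕ, ‖PowerSeries.coeff n
        (PowerSeries.C (ϖ : ℚ_[3]) * padicLFunctionMinusBranch f (unitRoot V 3 : ℚ_[3]) (3 / 2))‖ = 1) :
    MissingLowerBoundAt W 3 :=
  hX.missingLowerBoundAt_three_rankZero_of_ratCharEqOdd_of_unitCoeff hDel3 hGZK hmod hmodD hcm hr hna
    (hX.chiBranchRatCharEqOddAt_of_ratLowerDvdOdd hWu hE) hcert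

/-- **X3♯(G-ord) at `3`, `r_an = 0`, non-CM, non-anomalous: `BSD(E,3)` ⟸ the ONE-SIDED rational
Skinner–Urban containment on the odd branch of the twist (`ChiBranchRatLowerDvdOddAt W 3`, typed) + ONE
unit coefficient, and NOTHING ELSE typed; no image hypothesis anywhere**: Wuthrich's half `hWu` serves
BOTH the upgrade to the rational equality (§2) and — as `thm16_minusEigenCharIdeal_dvd_cyclotomicThree_of_half hWu`
— the UPPER half (additive-p1's reducible-twist chain at `3` inside p252109's
`ClassX3Gord.bsdp_three_rankZero_of_ratCharEqOdd_of_unitCoeff`); Delbourgo 2002 at `3` (`hDel3`) and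
Delbourgo 1998 Prop. 4 (`hDel`) are the printed `T = 0` controls. Nothing booked; X3♯(G-ord) stays
CONSTRUCTION-SHAPED. [cite: Wuthrich2014, Thm. 16 (p. 397)] [cite: SkinnerUrban2014, Cor. 3.6.2 (p. 42) (shape only)]
[cite: Delbourgo2002, Theorem (A), (B) (p. 40)] [cite: Delbourgo1998, Prop. 4 (p. 144)]
[cite: Miller2011LMS, §1 and Def. 1.1] -/
theorem ClassX3Gord.bsdp_three_rankZero_of_ratLowerDvdOdd_of_unitCoeff [Fact (Nat.Prime 3)]
    (hWu : Wuthrich2014.thm16_halfEigenCharIdeal_dvd_cyclotomicPrime)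
    (hDel3 : Delbourgo2002.mainTheorem_three)
    (hDel : Delbourgo1998.prop4_rankZero_pow_dvd_constantCoeff)
    (hGZK : rank_eq_analyticRank_of_analyticRank_le_one) (hmod : hasEntireLFunction_rat)
    (hmodD : nonempty_modularParametrizationData)
    (hX : ClassX3Gord W 3) (hcm : ¬ W.HasCM) (hr : W.analyticRank = 0)
    (hna : Delbourgo2002.ReductionNonAnomalous W 3) (hE : ChiBranchRatLowerDvdOddAt W 3)
    (hcert : ∀ (V : WeierstrassCurve ℚ) [V.IsElliptic] [V.IsGloballyMinimal] (C : VariableChange ℚ),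
      GoodOrd V 3 → C • V.quadraticTwist (-(3 : ℚ)) = W →
      ∀ {N : ℕ} [NeZero N] (f : CuspForm (Gamma0 N) 2), IsNewformOf V f →
      ∀ ϖ : ℚ, (ϖ : ℝ) * V.imaginaryPeriodRat = minusPeriod f →
      ∃ n : ℕ, ‖PowerSeries.coeff n
        (PowerSeries.C (ϖ : ℚ_[3]) * padicLFunctionMinusBranch f (unitRoot V 3 : ℚ_[3]) (3 / 2))‖ = 1) :
    BSDp W 3 :=
  hX.bsdp_three_rankZero_of_ratCharEqOdd_of_unitCoeff hDel3
    (thm16_minusEigenCharIdeal_dvd_cyclotomicThree_of_half hWu) hDel hGZK hmod hmodD hcm hr hna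
    (hX.chiBranchRatCharEqOddAt_of_ratLowerDvdOdd hWu hE) hcert

/-- **X3♯(G-ord) at `3`, `r_an = 0`, non-CM, non-anomalous, UNIT rows (`L(E,1) = q·Ω_E`, `ord₃ q = 0`):
`BSD(E,3)` ⟸ the one-sided rational Skinner–Urban containment on the odd branch ALONE** (certificate
free on the unit rows, census-ctyper-1 `CensusX41.unitCoeffCert_odd`; p252109 `…_of_unitLValue`). Here
`E[3]` is reducible and `3`-torsion is possible, so the LOWER half has content on the unit rows.
Nothing booked. [cite: Wuthrich2014, Thm. 16 (p. 397)] [cite: SkinnerUrban2014, Cor. 3.6.2 (p. 42) (shape only)]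
[cite: Delbourgo2002, Theorem (A), (B) (p. 40)] [cite: Delbourgo1998, Prop. 4 (p. 144)] [cite: Miller2011LMS, Def. 1.1] -/
theorem ClassX3Gord.bsdp_three_rankZero_of_ratLowerDvdOdd_of_unitLValue [Fact (Nat.Prime 3)]
    (hWu : Wuthrich2014.thm16_halfEigenCharIdeal_dvd_cyclotomicPrime)
    (hDel3 : Delbourgo2002.mainTheorem_three)
    (hDel : Delbourgo1998.prop4_rankZero_pow_dvd_constantCoeff)
    (hGZK : rank_eq_analyticRank_of_analyticRank_le_one) (hmod : hasEntireLFunction_rat)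
    (hmodD : nonempty_modularParametrizationData)
    (hX : ClassX3Gord W 3) (hcm : ¬ W.HasCM) (hr : W.analyticRank = 0)
    (hna : Delbourgo2002.ReductionNonAnomalous W 3) (hE : ChiBranchRatLowerDvdOddAt W 3)
    {q : ℚ} (hq : W.entireLFunction 1 = (q : ℂ) * (W.realPeriodRat : ℂ)) (hq0 : q ≠ 0)
    (hv : padicValRat 3 q = 0) :
    BSDp W 3 :=
  hX.bsdp_three_rankZero_of_ratCharEqOdd_of_unitLValue hDel3
    (thm16_minusEigenCharIdeal_dvd_cyclotomicThree_of_half hWu) hDel hGZK hmod hmodD hcm hr hna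
    (hX.chiBranchRatCharEqOddAt_of_ratLowerDvdOdd hWu hE) hq hq0 hv

end Three

end Summit.BirchSwinnertonDyer.Rank1Residual.Additive

end
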